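/-
Origin: expansion seat `planner-pub-hodgecm-mc-sanity-1-g3-0`, handover #1 2026-08-19T00:15Z md5 c77c9579db27fa1e329f2c9ad540297f (NEW, 255 l., 19 decls in namespace HodgeCM.Model.Sanity; imports ONLY the installed r32 twin HodgeCM.Vendored.H21.NumberTheory.Automorphic.ThetaClassSupply — install any time; rc 0 / 0 warnings / ~5 s; content: `thetaClasses ι D ⊥ = (↑) '' ker D.pull`, `pull = 0 ⇒ thetaClasses = D.H10`, all-classes datum `topClassMapDatum` (H10 := ⊤, pull  (`HOME/mc/pub-hodgecm-mc-sanity-1-g3/lean/ThetaClassesDegenerate.lean`, md5 c77c9579, 255 lines);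
landed by the gen-9 packager (p-g9) in gate run 33 as `HodgeCM/Model/Sanity/ThetaClassesDegenerate.lean` (verbatim).
-/
/-
Origin: SANITY lane `planner-pub-hodgecm-mc-sanity-1-g3-0` (unit pub-hodgecm-mc-sanity-1-g3, gen 3 of mc-sanity-1,
node SAN-5a), 2026-08-19.  NEW additive leaf under `HodgeCM/Model/Sanity/`; imports ONLY the installed (RUN 32)
vendored twin `HodgeCM.Vendored.H21.NumberTheory.Automorphic.ThetaClassSupply` (tree node W6b-2); nothing imports
it.  KERNEL: 0 records, 0 hypotheses minted, no global instances, no new constants of the model.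
Expected `#print axioms` of every declaration: ⊆ {propext, Classical.choice, Quot.sound}.
-/
import Literature.NumberTheory.Automorphic.ThetaClassSupply

/-!
# SAN-5a: `thetaClasses` is exactly as strong as the class-map datum's `pull` is injective

Node E pins its data binder `Theta` (revision 6) to `Model.thetaOf U I V c i Γ :=
WeightForms.thetaClasses (I V c).ιinf ((I V c).D Γ) ((I V c).Θ i Γ)` (`HodgeCM/Model/ThetaSideInstance`, mc-period-2-g4),
i.e. to the tree's theta classes of a space `Θ` of adelic weight forms THROUGH a class-map datum
`D : WeightForms.ClassMapDatum ιinf hΔ hη H` (fields `H10`, `pull : H10 →ₗ weightForms Δ κ₁ τ₁`, `Hol`, `descends`).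
The binders of the E term that quantify over theta classes (`classPacks` = `Nonempty ClassSupplyPack`, whose
exact strength is «some `Θ_k(Γ)` contains a nonzero class / a complex line», SAN-4 `ClassSupplyExact`; `hLiu`;
the `theta_sub` field of `ClassSupplyData`) therefore read their content off `D` as much as off `Θ`.

This file decides, in the kernel and for an ARBITRARY restriction situation `(ι, hΔ, hη)` and coefficient space
`H`, what `D` contributes:

* § 1 `mem_thetaClasses_of_pull_eq_zero` / `thetaClasses_bot_eq`: every class killed by `pull` is a theta class
  of EVERY space `Θ` (witness `F := 0`), and the theta classes of the ZERO space are exactly `ker pull`: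
  `thetaClasses ι D ⊥ = (↑) '' ker D.pull`.  `thetaClasses_eq_H10_of_pull_eq_zero`: if `pull = 0` then
  `thetaClasses ι D Θ = D.H10` for every `Θ`.
* § 2 the ALL-CLASSES datum `topClassMapDatum` (`H10 := ⊤`, `pull := 0`, `Hol := ⊥`; `descends` holds with the
  zero class) inhabits `ClassMapDatum ι hΔ hη H` over every situation, and `thetaClasses ι topClassMapDatum Θ =
  Set.univ` for every `Θ` — so «`Θ_k(Γ)` contains a nonzero theta class» is then equivalent to `Nontrivial H`
  (`exists_ne_zero_mem_thetaClasses_top_iff`) and says nothing about theta forms.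
* § 3 conversely, when `pull` is INJECTIVE the content flows entirely to `Θ`: `thetaClasses ι D ⊥ = {0}` and
  EXACT STRENGTH `exists_ne_zero_mem_thetaClasses_iff_of_injective`:
  `(∃ h ∈ thetaClasses ι D Θ, h ≠ 0) ↔ ∃ F ∈ Θ, restrictHom F ∈ D.Hol ∧ ∃ x, F (ι x) ≠ 0` — a nonzero theta class
  is the same thing as an adelic form of the space, holomorphic after restriction and NOT vanishing identically
  on the archimedean component `ι(G₁)` (the `→` direction is new; `←` is the tree's
  `WeightForms.exists_ne_zero_of_apply_ne_zero`).
* § 4 the restriction hypotheses `IsLevelCorrected` / `IsWeightMatched` are jointly satisfiable over any weight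
  module (all groups trivial, trivial weights: `punit_isLevelCorrected`, `punit_isWeightMatched`), so both
  degenerate data of § 2/§ 3 exist in every coefficient space `H`: `thetaClasses = univ` (top datum) and
  `thetaClasses ⊥ = {0}` (bottom datum `botClassMapDatum`, `H10 := ⊥`, injective `pull`).

VERDICT for the E ledger (MODEL-N += 0): after the pin `Theta := thetaOf U I`, a producer of the input record
`I` certifies theta-side content only if its class-map data `(I V c).D Γ` have injective `pull` (then, by § 3,
«nonzero class in `Θ_i(Γ)`» = «a form in `(I V c).Θ i Γ` non-vanishing on `G_U(ℝ)` and holomorphic after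
restriction»); with a non-injective `pull` the classes in `ker pull` discharge every such binder for free (§ 1–2).
`ClassMapDatum` itself does not record injectivity — it is a property the D3-geom / D1-aut CLASSMAP producer has
to PROVE of its term (harmonic representatives are unique), and the referees should ask for it by name.
-/

set_option autoImplicit false

noncomputable section

open Function Set

namespace HodgeCM
namespace Model
namespace Sanity

open Literature.NumberTheory.Automorphic Literature.NumberTheory.Automorphic.WeightForms

variable {GU : Type*} [Group GU] {G₁ : Type*} [Group G₁]
variable {Kc : Type*} [Group Kc] {K₁ : Type*} [Group K₁]
variable {W : Type*} [AddCommGroup W] [Module ℂ W]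
variable {ΓU : Subgroup GU} {κ : Kc →* GU} {τ : Representation ℂ Kc W}
variable (ι : G₁ →* GU) {Δ : Subgroup G₁} {κ₁ : K₁ →* G₁} {τ₁ : Representation ℂ K₁ W}
variable {hΔ : IsLevelCorrected ΓU κ τ ι Δ} {η₁ : K₁ →* Kc} {hη : IsWeightMatched κ τ ι κ₁ τ₁ η₁}
variable {H : Type*} [AddCommGroup H] [Module ℂ H]

/-! ## § 1. The kernel of `pull` consists of theta classes of every space -/

/-- A `(1,0)`-class killed by `pull` is a theta class of EVERY space of adelic forms `Θ` (witness `F := 0`). -/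
theorem mem_thetaClasses_of_pull_eq_zero (D : ClassMapDatum ι hΔ hη H) (Θ : Submodule ℂ (weightForms ΓU κ τ))
    {c : D.H10} (hc : D.pull c = 0) : (c : H) ∈ thetaClasses ι D Θ :=
  ⟨c, rfl, 0, Θ.zero_mem, by rw [map_zero]; exact D.Hol.zero_mem, by rw [map_zero, hc]⟩

/-- **The theta classes of the ZERO space are exactly `ker pull`.** -/
theorem thetaClasses_bot_eq (D : ClassMapDatum ι hΔ hη H) :
    thetaClasses ι D ⊥ = ((↑) : D.H10 → H) '' (LinearMap.ker D.pull : Set D.H10) := by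
  ext h
  constructor
  · rintro ⟨c, rfl, F, hF, -, hc⟩
    rw [Submodule.mem_bot] at hF
    subst hF
    rw [map_zero] at hc
    exact ⟨c, LinearMap.mem_ker.2 hc, rfl⟩
  · rintro ⟨c, hc, rfl⟩
    exact mem_thetaClasses_of_pull_eq_zero ι D ⊥ (LinearMap.mem_ker.1 hc)

/-- `ker pull` lies in the theta classes of every space. -/
theorem image_ker_pull_subset_thetaClasses (D : ClassMapDatum ι hΔ hη H)
    (Θ : Submodule ℂ (weightForms ΓU κ τ)) :
    ((↑) : D.H10 → H) '' (LinearMap.ker D.pull : Set D.H10) ⊆ thetaClasses ι D Θ := by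
  rw [← thetaClasses_bot_eq]
  exact thetaClasses_mono ι D bot_le

/-- **If `pull = 0`, every `(1,0)`-class is a theta class of every space**: `thetaClasses ι D Θ = D.H10`. -/
theorem thetaClasses_eq_H10_of_pull_eq_zero (D : ClassMapDatum ι hΔ hη H) (h0 : D.pull = 0)
    (Θ : Submodule ℂ (weightForms ΓU κ τ)) : thetaClasses ι D Θ = D.H10 := by
  refine Subset.antisymm (thetaClasses_subset ι D Θ) fun h hh => ?_
  exact mem_thetaClasses_of_pull_eq_zero ι D Θ (c := ⟨h, hh⟩) (by rw [h0]; rfl)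

/-! ## § 2. The all-classes datum: `thetaClasses = univ` whatever `Θ` is -/

/-- **The all-classes datum**: `H10 := ⊤`, `pull := 0`, `Hol := ⊥` (descent holds with the zero class).
It inhabits `ClassMapDatum ι hΔ hη H` over EVERY restriction situation and coefficient space. -/
def topClassMapDatum (hΔ : IsLevelCorrected ΓU κ τ ι Δ) (hη : IsWeightMatched κ τ ι κ₁ τ₁ η₁)
    (H : Type*) [AddCommGroup H] [Module ℂ H] : ClassMapDatum ι hΔ hη H where
  H10 := ⊤
  pull := 0
  Hol := ⊥
  descends f hf := ⟨0, by rw [(Submodule.mem_bot ℂ).1 hf, map_zero]⟩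

/-- (Ported verbatim from the HodgeCMPerL package; no docstring in the source.) -/
@[simp] theorem topClassMapDatum_H10 : (topClassMapDatum ι hΔ hη H).H10 = ⊤ := rfl
/-- (Ported verbatim from the HodgeCMPerL package; no docstring in the source.) -/
@[simp] theorem topClassMapDatum_pull : (topClassMapDatum ι hΔ hη H).pull = 0 := rfl
/-- (Ported verbatim from the HodgeCMPerL package; no docstring in the source.) -/
@[simp] theorem topClassMapDatum_Hol : (topClassMapDatum ι hΔ hη H).Hol = ⊥ := rfl

/-- **Every class is a theta class of every space** through the all-classes datum. -/
theorem thetaClasses_topClassMapDatum (Θ : Submodule ℂ (weightForms ΓU κ τ)) :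
    thetaClasses ι (topClassMapDatum ι hΔ hη H) Θ = univ := by
  rw [thetaClasses_eq_H10_of_pull_eq_zero ι _ rfl, topClassMapDatum_H10, Submodule.top_coe]

/-- Hence «`Θ` has a nonzero theta class» through the all-classes datum is `Nontrivial H` — a statement about the
coefficient space, not about theta forms (it holds for `Θ := ⊥`). -/
theorem exists_ne_zero_mem_thetaClasses_top_iff (Θ : Submodule ℂ (weightForms ΓU κ τ)) :
    (∃ h ∈ thetaClasses ι (topClassMapDatum ι hΔ hη H) Θ, h ≠ 0) ↔ Nontrivial H := by
  rw [thetaClasses_topClassMapDatum, nontrivial_iff_exists_ne (0 : H)]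
  simp

/-- In particular over a nontrivial coefficient space the ZERO space of adelic forms already has a nonzero theta
class through the all-classes datum. -/
theorem exists_ne_zero_mem_thetaClasses_top_bot [Nontrivial H] :
    ∃ h ∈ thetaClasses ι (topClassMapDatum ι hΔ hη H) ⊥, h ≠ 0 :=
  (exists_ne_zero_mem_thetaClasses_top_iff ι ⊥).2 ‹_›

/-! ## § 3. Injective `pull`: the content is exactly in `Θ` -/

/-- With injective `pull` the zero space has only the zero theta class. -/
theorem thetaClasses_bot_of_injective (D : ClassMapDatum ι hΔ hη H) (hinj : Injective D.pull) :
    thetaClasses ι D ⊥ = {0} := by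
  rw [thetaClasses_bot_eq, LinearMap.ker_eq_bot.2 hinj]
  ext h
  simp

/-- With injective `pull`, a NONZERO theta class of `Θ` comes from a form of `Θ`, holomorphic after restriction,
that does not vanish identically on the archimedean component `ι(G₁)`. -/
theorem exists_apply_ne_zero_of_mem_thetaClasses (D : ClassMapDatum ι hΔ hη H) (hinj : Injective D.pull)
    {Θ : Submodule ℂ (weightForms ΓU κ τ)} {h : H} (hh : h ∈ thetaClasses ι D Θ) (h0 : h ≠ 0) :
    ∃ F ∈ Θ, restrictHom ι hΔ hη F ∈ D.Hol ∧ ∃ x : G₁, (F : GU → W) (ι x) ≠ 0 := by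
  obtain ⟨c, rfl, F, hF, hHol, hc⟩ := hh
  refine ⟨F, hF, hHol, ?_⟩
  by_contra hx
  have hx' : ∀ x : G₁, (F : GU → W) (ι x) = 0 := fun x => by_contra fun hne => hx ⟨x, hne⟩
  have hF0 : restrictHom ι hΔ hη F = 0 := (restrictHom_eq_zero_iff ι hΔ hη F).2 hx'
  have hc0 : c = 0 := hinj (by rw [hc, hF0, map_zero])
  exact h0 (by rw [hc0]; rfl)

/-- **EXACT STRENGTH for injective class-map data**: a nonzero theta class of `Θ` is the same thing as a form of
`Θ`, holomorphic after restriction, non-vanishing somewhere on `ι(G₁)`.  (`←` is the tree's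
`WeightForms.exists_ne_zero_of_apply_ne_zero`.) -/
theorem exists_ne_zero_mem_thetaClasses_iff_of_injective (D : ClassMapDatum ι hΔ hη H) (hinj : Injective D.pull)
    (Θ : Submodule ℂ (weightForms ΓU κ τ)) :
    (∃ h ∈ thetaClasses ι D Θ, h ≠ 0) ↔
      ∃ F ∈ Θ, restrictHom ι hΔ hη F ∈ D.Hol ∧ ∃ x : G₁, (F : GU → W) (ι x) ≠ 0 := by
  constructor
  · rintro ⟨h, hh, h0⟩
    exact exists_apply_ne_zero_of_mem_thetaClasses ι D hinj hh h0
  · rintro ⟨F, hF, hHol, x, hx⟩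
    exact exists_ne_zero_of_apply_ne_zero ι D hF hx hHol

/-- The bottom datum: `H10 := ⊥`, `pull := 0` (injective on `⊥`), `Hol := ⊥`.  Through it NO space has a nonzero
theta class. -/
def botClassMapDatum (hΔ : IsLevelCorrected ΓU κ τ ι Δ) (hη : IsWeightMatched κ τ ι κ₁ τ₁ η₁)
    (H : Type*) [AddCommGroup H] [Module ℂ H] : ClassMapDatum ι hΔ hη H where
  H10 := ⊥
  pull := 0
  Hol := ⊥
  descends f hf := ⟨0, by rw [(Submodule.mem_bot ℂ).1 hf, map_zero]⟩

/-- (Ported verbatim from the HodgeCMPerL package; no docstring in the source.) -/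
@[simp] theorem botClassMapDatum_H10 : (botClassMapDatum ι hΔ hη H).H10 = ⊥ := rfl
/-- (Ported verbatim from the HodgeCMPerL package; no docstring in the source.) -/
@[simp] theorem botClassMapDatum_pull : (botClassMapDatum ι hΔ hη H).pull = 0 := rfl
/-- (Ported verbatim from the HodgeCMPerL package; no docstring in the source.) -/
@[simp] theorem botClassMapDatum_Hol : (botClassMapDatum ι hΔ hη H).Hol = ⊥ := rfl

/-- (Ported verbatim from the HodgeCMPerL package; no docstring in the source.) -/
theorem botClassMapDatum_pull_injective : Injective (botClassMapDatum ι hΔ hη H).pull := by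
  intro a b _
  apply Subtype.ext
  have ha : (a : H) ∈ (⊥ : Submodule ℂ H) := a.2
  have hb : (b : H) ∈ (⊥ : Submodule ℂ H) := b.2
  rw [Submodule.mem_bot] at ha hb
  rw [ha, hb]

/-- Through the bottom datum every space has exactly the zero theta class. -/
theorem thetaClasses_botClassMapDatum (Θ : Submodule ℂ (weightForms ΓU κ τ)) :
    thetaClasses ι (botClassMapDatum ι hΔ hη H) Θ = {0} := by
  refine Subset.antisymm ?_ ?_
  · intro h hh
    have := thetaClasses_subset ι _ Θ hh
    simpa [botClassMapDatum] using this
  · rintro h rfl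
    exact zero_mem_thetaClasses ι _ Θ

/-- So the two degenerate data give OPPOSITE verdicts on the same space `Θ`: the predicate «`Θ` has a nonzero
theta class through `D`» is decided by `D`, not by `Θ`, unless `pull` is injective with `H10`, `Hol` honest. -/
theorem thetaClasses_top_ne_bot [Nontrivial H] (Θ : Submodule ℂ (weightForms ΓU κ τ)) :
    thetaClasses ι (topClassMapDatum ι hΔ hη H) Θ ≠ thetaClasses ι (botClassMapDatum ι hΔ hη H) Θ := by
  rw [thetaClasses_topClassMapDatum, thetaClasses_botClassMapDatum]
  intro h
  obtain ⟨x, hx⟩ := exists_ne (0 : H)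
  have : x ∈ ({0} : Set H) := h ▸ mem_univ x
  exact hx this

/-! ## § 4. The restriction hypotheses are jointly satisfiable (all groups trivial) -/

section Trivial

variable (W' : Type*) [AddCommGroup W'] [Module ℂ W']

/-- Level correction holds for the trivial situation `GU = G₁ = Kc = PUnit`, `ΓU = ⊤`, trivial weight. -/
theorem punit_isLevelCorrected (Δ' : Subgroup PUnit.{1}) :
    IsLevelCorrected (⊤ : Subgroup PUnit.{1}) (MonoidHom.id PUnit.{1}) (1 : Representation ℂ PUnit.{1} W')
      (MonoidHom.id PUnit.{1}) Δ' :=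
  fun _ _ => ⟨1, map_one _, Subgroup.mem_top _, fun _ => Commute.all _ _⟩

/-- Weight matching holds for the trivial situation (`K₁ = PUnit`, `η₁ = id`, both weights trivial). -/
theorem punit_isWeightMatched :
    IsWeightMatched (MonoidHom.id PUnit.{1}) (1 : Representation ℂ PUnit.{1} W') (MonoidHom.id PUnit.{1})
      (MonoidHom.id PUnit.{1}) (1 : Representation ℂ PUnit.{1} W') (MonoidHom.id PUnit.{1}) :=
  ⟨fun _ => rfl, fun _ => rfl⟩

/-- Over the trivial situation and ANY nontrivial coefficient space, the all-classes datum makes the zero space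
of adelic forms supply a nonzero theta class … -/
theorem exists_ne_zero_thetaClass_trivialSituation (H' : Type*) [AddCommGroup H'] [Module ℂ H'] [Nontrivial H'] :
    ∃ h ∈ thetaClasses (MonoidHom.id PUnit.{1})
        (topClassMapDatum (MonoidHom.id PUnit.{1}) (punit_isLevelCorrected W' ⊤) (punit_isWeightMatched W') H')
        (⊥ : Submodule ℂ (weightForms (⊤ : Subgroup PUnit.{1}) (MonoidHom.id PUnit.{1})
          (1 : Representation ℂ PUnit.{1} W'))), h ≠ 0 :=
  exists_ne_zero_mem_thetaClasses_top_bot _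

/-- … while the bottom datum over the same situation makes EVERY space supply only `0`. -/
theorem thetaClasses_trivialSituation_bot (H' : Type*) [AddCommGroup H'] [Module ℂ H']
    (Θ : Submodule ℂ (weightForms (⊤ : Subgroup PUnit.{1}) (MonoidHom.id PUnit.{1})
      (1 : Representation ℂ PUnit.{1} W'))) :
    thetaClasses (MonoidHom.id PUnit.{1})
        (botClassMapDatum (MonoidHom.id PUnit.{1}) (punit_isLevelCorrected W' ⊤) (punit_isWeightMatched W') H')
        Θ = {0} :=
  thetaClasses_botClassMapDatum _ Θ

end Trivial

end Sanity
end Model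
end HodgeCM

end
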